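import Mathlib
import Summits.AtomisticToContinuum.Crystallization.Theorems.PricedLinkCensusStackingHingeKinematicCompactness
import Summits.AtomisticToContinuum.Crystallization.Theorems.PricedLinkCensusStackingHingeBlameCount
import Summits.AtomisticToContinuum.Crystallization.Theorems.PricedLinkCensusStackingHingeHcpChartsIntegrate
import Literature.Geometry.DiscreteGeometry.BondGraph
import Literature.MathematicalPhysics.StatisticalMechanics.LennardJonesClusters
import Literature.MathematicalPhysics.StatisticalMechanics.HaggStacking
import Literature.MathematicalPhysics.StatisticalMechanics.BarlowStacking
import Literature.MathematicalPhysics.StatisticalMechanics.HcpHomogeneous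
import Literature.MathematicalPhysics.StatisticalMechanics.HcpSiteGeometry

/-!
# Route PricedLinkCensus — `Weak ⇐ WeakLocal` for line Sketch of `StackingHinge` (stmt-AtomisticToContinuum-14993)
(stub `stub_weakOfWeakLocal`; lead c1)

The line's hard stub was the WEAK form `WeakHcpWindowsAt a h`: a.e.-good (`#B_L ≤ βN`), near-optimal (`E ≤ N(e* + η)`),
`δ₀`-separated finite configurations have `≥ ρN` sites whose `R`-window is two-way `ε`-matched with a rigid image of
`barlowStacking a h alternatingHagg`, for every `(R, ε)`.  This file proves that the window radius is KINEMATICS: the weak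
form follows from the WEAK LOCAL form `WeakLocalHcpAt a h` — for every tolerance `θ` and density `ν`, such configurations have
at most `νN` sites whose window of the FIXED radius `3a + 1` is not two-way `θ`-matched — using three landed stubs of the line:

* `PricedHcpWindowsKinematicCompactness.stub_kinematicCompactness` (p118073): for a uniformly discrete point set of finite local
  complexity whose exact local charts integrate exactly, `θ(R, ε)`-accurate local charts on an `(R + 2)`-ball give an
  `ε`-accurate chart of radius `R` (compactness);
* `PricedHcpWindowsHcpCharts.stub_hcpChartsIntegrate` (p118317): exact local hcp charts of radius `≥ 3a` integrate exactly;
* `PricedHcpWindowsBlameCount.stub_blameCount` (p118184): `#{¬P} ≤ C(δ₀, D)·#{Q}` when every `¬P`-site has a `Q`-site within `D`.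

§1 supplies the two facts about `hcpStacking a h` needed by the compactness stub — uniform discreteness (`hcp_sep`: distinct
sites are `≥ min a h` apart) and finite local complexity (`hcp_flc`: the centred patterns `S − z`, `z ∈ S`, are `S` or
`halfTurn '' S`, by `hcp_add_of_even` / `hcp_add_halfTurn_of_odd`).  §2 is the theorem: `θ` from the compactness stub at
`(δ, r, R, R') = (min δ₀ (min a h), 3a, R, R + 3a + 4)`, applied to the recentred `R'`-window of each site all of whose neighbours
within `R + 2` are locally `min θ 1`-matched (the charts are transported by the translation `· − y i`, `AffineIsometryEquiv.vaddConst`);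
every other site is blamed on a locally unmatched site within `R + 2`, and `ν := 1/(2(C_b + 1))` leaves `≥ N/2` matched sites.

All `[folklore]`.
-/

namespace Summit.AtomisticToContinuum.Crystallization.Theorems.PricedHcpWindowsWeakOfLocal

open Literature.MathematicalPhysics.StatisticalMechanics

/-! ## hcp: separation and finite local complexity -/

/-- Negating a point of an even hcp layer. -/
theorem neg_barlowPos_of_even {a h : ℝ} {k : ℤ} (hk : Even k) (i j : ℤ) :
    -barlowPos a h alternatingHagg k i j = barlowPos a h alternatingHagg (-k) (-i) (-j) := by
  have h1 := haggLabel_alternating_of_even hk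
  have h2 := haggLabel_alternating_of_even (Even.neg hk)
  ext l; fin_cases l <;> simp [barlowPos, h1, h2, triangularVec₁, triangularVec₂, barlowOffset, layerNormal]
  ring

/-- **Centred patches of hcp**: `S − z ∈ {S, halfTurn '' S}` for every site `z` (homogeneity). -/
theorem hcp_sub_image_mem {a h : ℝ} {z : EuclideanSpace ℝ (Fin 3)} (hz : z ∈ hcpStacking a h) :
    (fun s => s - z) '' hcpStacking a h = hcpStacking a h ∨
      (fun s => s - z) '' hcpStacking a h = halfTurn '' hcpStacking a h := by
  obtain ⟨k, i, j, rfl⟩ := hz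
  rcases Int.even_or_odd k with hk | hk
  · left
    ext s
    constructor
    · rintro ⟨s', ⟨k', i', j', rfl⟩, rfl⟩
      refine ⟨k' + -k, i' + -i, j' + -j, ?_⟩
      show barlowPos a h alternatingHagg k' i' j' - barlowPos a h alternatingHagg k i j = _
      rw [sub_eq_add_neg, neg_barlowPos_of_even hk, add_comm, hcp_add_of_even a h (Even.neg hk)]
      congr 1 <;> ring
    · rintro ⟨k', i', j', rfl⟩
      refine ⟨barlowPos a h alternatingHagg k i j + barlowPos a h alternatingHagg k' i' j', ?_, by simp⟩
      rw [hcp_add_of_even a h hk]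
      exact ⟨_, _, _, rfl⟩
  · right
    ext s
    constructor
    · rintro ⟨s', ⟨k', i', j', rfl⟩, rfl⟩
      refine ⟨barlowPos a h alternatingHagg (k' - k) (i - i') (j - j'), ⟨_, _, _, rfl⟩, ?_⟩
      have := hcp_add_halfTurn_of_odd a h hk i j (k' - k) (i - i') (j - j')
      simp only [add_sub_cancel, sub_sub_cancel] at this
      show halfTurn _ = _ - _
      rw [eq_sub_iff_add_eq, add_comm, this]
    · rintro ⟨q, ⟨k', i', j', rfl⟩, rfl⟩
      refine ⟨barlowPos a h alternatingHagg k i j + halfTurn (barlowPos a h alternatingHagg k' i' j'), ?_, by simp⟩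
      rw [hcp_add_halfTurn_of_odd a h hk]
      exact ⟨_, _, _, rfl⟩

/-- **hcp has finite local complexity** (indeed at most two centred patterns). -/
theorem hcp_flc (a h ρ : ℝ) :
    Set.Finite {T : Set (EuclideanSpace ℝ (Fin 3)) | ∃ z ∈ hcpStacking a h,
      T = (fun s => s - z) '' hcpStacking a h ∩ Metric.closedBall (0 : EuclideanSpace ℝ (Fin 3)) ρ} := by
  refine (Set.toFinite ({hcpStacking a h ∩ Metric.closedBall (0 : EuclideanSpace ℝ (Fin 3)) ρ,
    halfTurn '' hcpStacking a h ∩ Metric.closedBall (0 : EuclideanSpace ℝ (Fin 3)) ρ} : Set (Set (EuclideanSpace ℝ (Fin 3))))).subset ?_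
  rintro T ⟨z, hz, rfl⟩
  rcases hcp_sub_image_mem hz with h1 | h1 <;> simp [h1]

/-- **hcp is uniformly discrete**: distinct sites are at distance `≥ min a h` (`0 < a`, `0 < h`). -/
theorem hcp_sep {a h : ℝ} (ha : 0 < a) (hh : 0 < h) {z z' : EuclideanSpace ℝ (Fin 3)} (hz : z ∈ hcpStacking a h)
    (hz' : z' ∈ hcpStacking a h) (hne : z ≠ z') : min a h ≤ dist z z' := by
  obtain ⟨k, i, j, rfl⟩ := hz
  obtain ⟨k', i', j', rfl⟩ := hz'
  by_cases hk : k = k'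
  · subst hk
    -- same layer: the in-layer form is a positive integer
    have hsq := hcp_dist_sq_eq a h k i j k i' j'
    simp only [sub_self, zero_mul, add_zero, zero_div, zero_pow two_ne_zero] at hsq
    have hform : (1 : ℝ) ≤ ((i : ℝ) - i') ^ 2 + ((i : ℝ) - i') * ((j : ℝ) - j') + ((j : ℝ) - j') ^ 2 := by
      have hint : (1 : ℤ) ≤ (i - i') ^ 2 + (i - i') * (j - j') + (j - j') ^ 2 := by
        by_contra hlt
        push Not at hlt
        have h0 : (i - i') ^ 2 + (i - i') * (j - j') + (j - j') ^ 2 = 0 := by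
          have : 0 ≤ (i - i') ^ 2 + (i - i') * (j - j') + (j - j') ^ 2 := by nlinarith [sq_nonneg (i - i' + (j - j')), sq_nonneg (i - i'), sq_nonneg (j - j')]
          omega
        have hi : i - i' = 0 := by nlinarith [sq_nonneg (i - i' + (j - j')), sq_nonneg (2 * (i - i') + (j - j')), sq_nonneg (j - j')]
        have hj : j - j' = 0 := by nlinarith [sq_nonneg (i - i' + (j - j')), sq_nonneg (j - j')]
        apply hne
        rw [sub_eq_zero.1 hi, sub_eq_zero.1 hj]
      exact_mod_cast hint
    have hd : a ^ 2 ≤ dist (barlowPos a h alternatingHagg k i j) (barlowPos a h alternatingHagg k i' j') ^ 2 := by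
      rw [hsq]; nlinarith
    have hdn : 0 ≤ dist (barlowPos a h alternatingHagg k i j) (barlowPos a h alternatingHagg k i' j') :=
      dist_nonneg
    calc min a h ≤ a := min_le_left _ _
      _ ≤ dist _ _ := by nlinarith [hdn, hd, ha]
  · -- different layers: the height difference is a nonzero multiple of `h`
    have h3 : (barlowPos a h alternatingHagg k i j - barlowPos a h alternatingHagg k' i' j') 2 =
        ((k : ℝ) - k') * h := by
      simp [barlowPos, triangularVec₁, triangularVec₂, barlowOffset, layerNormal]; ring
    have hk1 : (1 : ℝ) ≤ |(k : ℝ) - k'| := by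
      have : (1 : ℤ) ≤ |k - k'| := Int.one_le_abs (sub_ne_zero.2 hk)
      have := (Int.cast_le (R := ℝ)).2 this
      simpa using this
    calc min a h ≤ h := min_le_right _ _
      _ ≤ |(k : ℝ) - k'| * h := le_mul_of_one_le_left hh.le hk1
      _ = |((k : ℝ) - k') * h| := by rw [abs_mul, abs_of_pos hh]
      _ = |(barlowPos a h alternatingHagg k i j - barlowPos a h alternatingHagg k' i' j') 2| := by rw [h3]
      _ ≤ ‖barlowPos a h alternatingHagg k i j - barlowPos a h alternatingHagg k' i' j'‖ := by
          simpa using PiLp.norm_apply_le (barlowPos a h alternatingHagg k i j - barlowPos a h alternatingHagg k' i' j') 2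
      _ = dist _ _ := (dist_eq_norm _ _).symm

/-! ## `Weak ⇐ WeakLocal`: the window radius `(R, ε)` leaves the energetic problem -/

/-- **`Weak ⇐ WeakLocal`.**  If, for every tolerance `θ` and density `ν`, a.e.-good near-optimal configurations have at
most `νN` sites whose `(3a+1)`-window is not `θ`-matched with a rigid image of hcp(a, h) (`WeakLocalHcpAt`), then they
have `≥ N/2` sites whose `R`-window is `ε`-matched, for every `(R, ε)` (`WeakHcpWindowsAt`).  Proof: `θ(R, ε)` from the
generic compactness upgrade (`stub_kinematicCompactness` for `S = hcp(a,h)`: uniformly discrete, finite local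
complexity `hcp_flc`, exact integration `stub_hcpChartsIntegrate`), applied to the recentred `(R + 3a + 4)`-window of each
site all of whose neighbours within `R + 2` are locally matched; the other sites are blamed on a locally unmatched site
within `R + 2` (`stub_blameCount`), and `ν := 1/(2(C_b + 1))`. [folklore] -/
theorem stub_weakOfWeakLocal : ∀ (a h : ℝ), 0 < a → 39 / 50 * a ≤ h → h ≤ 17 / 20 * a → (∀ δ₀ θ ν : ℝ, 0 < δ₀ → 0 < θ → 0 < ν → ∃ η β L : ℝ, 0 < η ∧ 0 < β ∧ 0 < L ∧ ∀ (N : ℕ) (y : Fin N → EuclideanSpace ℝ (Fin 3)), Function.Injective y → (∀ i j : Fin N, i ≠ j → δ₀ ≤ dist (y i) (y j)) → (Nat.card {i : Fin N // ¬ (∀ j : Fin N, dist (y i) (y j) ≤ L * Literature.Geometry.DiscreteGeometry.nearestDist y i → Literature.Geometry.DiscreteGeometry.IsChargeFree (1 / 100 : ℝ) y j)} : ℝ) ≤ β * N → Literature.MathematicalPhysics.StatisticalMechanics.interactionEnergy Literature.MathematicalPhysics.StatisticalMechanics.lennardJones y ≤ (N : ℝ) * ((⨅ Q : Literature.MathematicalPhysics.StatisticalMechanics.PeriodicConfiguration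 3, Q.energyPerParticle Literature.MathematicalPhysics.StatisticalMechanics.lennardJones) + η) → (Nat.card {i : Fin N // ¬ (∃ g : EuclideanSpace ℝ (Fin 3) ≃ᵃⁱ[ℝ] EuclideanSpace ℝ (Fin 3), (∀ j : Fin N, dist (y i) (y j) ≤ (3 * a + 1) → ∃ z ∈ Literature.MathematicalPhysics.StatisticalMechanics.barlowStacking a h Literature.MathematicalPhysics.StatisticalMechanics.alternatingHagg, dist (y j) (g z) ≤ θ) ∧ (∀ z ∈ Literature.MathematicalPhysics.StatisticalMechanics.barlowStacking a h Literature.MathematicalPhysics.StatisticalMechanics.alternatingHagg, dist (y i) (g z) ≤ (3 * a + 1) → ∃ j : Fin N, dist (y j) (g z) ≤ θ))} : ℝ) ≤ ν * N) → ∀ δ₀ : ℝ, 0 < δ₀ → ∀ R ε : ℝ, 0 < R → 0 < ε → ∃ η β L ρ : ℝ, 0 < η ∧ 0 < β ∧ 0 < L ∧ 0 < ρ ∧ ∀ (N : ℕ) (y : Fin N → EuclideanSpace ℝ (Fin 3)), Function.Injective y → (∀ i j : Fin N, i ≠ j → δ₀ ≤ dist (y i) (y j)) → (Nat.card {i : Fin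 N // ¬ (∀ j : Fin N, dist (y i) (y j) ≤ L * Literature.Geometry.DiscreteGeometry.nearestDist y i → Literature.Geometry.DiscreteGeometry.IsChargeFree (1 / 100 : ℝ) y j)} : ℝ) ≤ β * N → Literature.MathematicalPhysics.StatisticalMechanics.interactionEnergy Literature.MathematicalPhysics.StatisticalMechanics.lennardJones y ≤ (N : ℝ) * ((⨅ Q : Literature.MathematicalPhysics.StatisticalMechanics.PeriodicConfiguration 3, Q.energyPerParticle Literature.MathematicalPhysics.StatisticalMechanics.lennardJones) + η) → ρ * (N : ℝ) ≤ (Nat.card {i : Fin N // ∃ g : EuclideanSpace ℝ (Fin 3) ≃ᵃⁱ[ℝ] EuclideanSpace ℝ (Fin 3), (∀ j : Fin N, dist (y i) (y j) ≤ R → ∃ z ∈ Literature.MathematicalPhysics.StatisticalMechanics.barlowStacking a h Literature.MathematicalPhysics.StatisticalMechanics.alternatingHagg, dist (y j) (g z) ≤ ε) ∧ (∀ z ∈ Literature.MathematicalPhysics.StatisticalMechanics.barlowStacking a h Literature.MathematicalPhysics.StatisticalMechanics.alternatingHagg, dist (y i) (g z) ≤ R → ∃ j : Fin N, dist (y j)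 (g z) ≤ ε)} : ℝ) := by
  intro a h ha h1 h2 hWL δ₀ hδ₀ R ε hR hε
  have hh : 0 < h := by linarith
  set δ : ℝ := min δ₀ (min a h) with hδdef
  have hδ : 0 < δ := lt_min hδ₀ (lt_min ha hh)
  have hδS : ∀ z ∈ (Literature.MathematicalPhysics.StatisticalMechanics.barlowStacking a h Literature.MathematicalPhysics.StatisticalMechanics.alternatingHagg), ∀ z' ∈ (Literature.MathematicalPhysics.StatisticalMechanics.barlowStacking a h Literature.MathematicalPhysics.StatisticalMechanics.alternatingHagg), z ≠ z' → δ ≤ dist z z' := fun z hz z' hz' hne =>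
    (min_le_right _ _).trans (hcp_sep ha hh hz hz' hne)
  have hr : (0 : ℝ) < 3 * a := by positivity
  have hR' : R + 3 * a + 3 ≤ R + 3 * a + 4 := by linarith
  obtain ⟨θ₀, hθ₀, hKC⟩ := PricedHcpWindowsKinematicCompactness.stub_kinematicCompactness (Literature.MathematicalPhysics.StatisticalMechanics.barlowStacking a h Literature.MathematicalPhysics.StatisticalMechanics.alternatingHagg) δ (3 * a) R (R + 3 * a + 4) hδ hr hR hR' hδS
    (hcp_flc a h) (fun W _ h0W _ hcharts => by
      obtain ⟨g, hg1, hg2⟩ := PricedHcpWindowsHcpCharts.stub_hcpChartsIntegrate a h ha h1 h2 (3 * a) R le_rfl hR W h0W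
        (fun w hw hwR => hcharts w hw (by linarith))
      exact ⟨g, fun w' hw' hd => hg1 w' hw' (by rwa [dist_comm, dist_zero_right] at hd),
        fun z hz hd => hg2 z hz (by rwa [dist_comm, dist_zero_right] at hd)⟩) ε hε
  obtain ⟨Cb, hCb0, hblame⟩ := PricedHcpWindowsBlameCount.stub_blameCount δ₀ (R + 2) hδ₀ (by linarith)
  set θ : ℝ := min θ₀ 1 with hθdef
  have hθ : 0 < θ := lt_min hθ₀ one_pos
  have hθ1 : θ ≤ 1 := min_le_right _ _
  have hθθ₀ : θ ≤ θ₀ := min_le_left _ _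
  set ν : ℝ := 1 / (2 * (Cb + 1)) with hνdef
  have hν : 0 < ν := by positivity
  obtain ⟨η, β, L, hη, hβ, hL, hmain⟩ := hWL δ₀ θ ν hδ₀ hθ hν
  refine ⟨η, β, L, 1 / 2, hη, hβ, hL, by norm_num, ?_⟩
  intro N y hy hsep hB hE
  have hbadloc := hmain N y hy hsep hB hE
  -- KEY: local charts on the `(R+2)`-ball integrate to an `(R, ε)`-match
  have key : ∀ i : Fin N, (∀ j : Fin N, dist (y i) (y j) ≤ R + 2 → (∃ g : EuclideanSpace ℝ (Fin 3) ≃ᵃⁱ[ℝ] EuclideanSpace ℝ (Fin 3), (∀ k : Fin N, dist (y j) (y k) ≤ (3 * a + 1) → ∃ z ∈ Literature.MathematicalPhysics.StatisticalMechanics.barlowStacking a h Literature.MathematicalPhysics.StatisticalMechanics.alternatingHagg, dist (y k) (g z) ≤ θ) ∧ (∀ z ∈ Literature.MathematicalPhysics.StatisticalMechanics.barlowStacking a h Literature.MathematicalPhysics.StatisticalMechanics.alternatingHagg, dist (y j) (g z) ≤ (3 * a + 1) → ∃ k : Fin N, dist (y k) (g z) ≤ θ))) →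
      (∃ g : EuclideanSpace ℝ (Fin 3) ≃ᵃⁱ[ℝ] EuclideanSpace ℝ (Fin 3), (∀ j : Fin N, dist (y i) (y j) ≤ R → ∃ z ∈ Literature.MathematicalPhysics.StatisticalMechanics.barlowStacking a h Literature.MathematicalPhysics.StatisticalMechanics.alternatingHagg, dist (y j) (g z) ≤ ε) ∧ (∀ z ∈ Literature.MathematicalPhysics.StatisticalMechanics.barlowStacking a h Literature.MathematicalPhysics.StatisticalMechanics.alternatingHagg, dist (y i) (g z) ≤ R → ∃ j : Fin N, dist (y j) (g z) ≤ ε)) := by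
    intro i hloc
    set W : Set (EuclideanSpace ℝ (Fin 3)) := (fun j : Fin N => y j - y i) '' {j | dist (y i) (y j) ≤ R + 3 * a + 4} with hWdef
    have hmemW : ∀ k : Fin N, dist (y i) (y k) ≤ R + 3 * a + 4 → y k - y i ∈ W := fun k hk => ⟨k, hk, rfl⟩
    have hWsub : W ⊆ Metric.closedBall (0 : EuclideanSpace ℝ (Fin 3)) (R + 3 * a + 4) := by
      rintro w ⟨j, hj, rfl⟩
      rw [Metric.mem_closedBall, dist_zero_right, ← dist_eq_norm, dist_comm]
      exact hj
    have h0W : (0 : EuclideanSpace ℝ (Fin 3)) ∈ W := ⟨i, by rw [Set.mem_setOf_eq, dist_self]; positivity, sub_self _⟩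
    have hWsep : ∀ w ∈ W, ∀ w' ∈ W, w ≠ w' → δ ≤ dist w w' := by
      rintro w ⟨j, hj, rfl⟩ w' ⟨k, hk, rfl⟩ hne
      have hjk : j ≠ k := fun hjk => hne (by rw [hjk])
      calc δ ≤ δ₀ := min_le_left _ _
        _ ≤ dist (y j) (y k) := hsep j k hjk
        _ = dist (y j - y i) (y k - y i) := (dist_sub_right _ _ _).symm
    have hcharts : ∀ w ∈ W, ‖w‖ ≤ R + 2 → ∃ g : EuclideanSpace ℝ (Fin 3) ≃ᵃⁱ[ℝ] EuclideanSpace ℝ (Fin 3),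
        (∀ w' ∈ W, dist w w' ≤ 3 * a + 1 → ∃ z ∈ (Literature.MathematicalPhysics.StatisticalMechanics.barlowStacking a h Literature.MathematicalPhysics.StatisticalMechanics.alternatingHagg), dist w' (g z) ≤ θ₀) ∧
        (∀ z ∈ (Literature.MathematicalPhysics.StatisticalMechanics.barlowStacking a h Literature.MathematicalPhysics.StatisticalMechanics.alternatingHagg), dist w (g z) ≤ 3 * a + 1 → ∃ w' ∈ W, dist w' (g z) ≤ θ₀) := by
      rintro w ⟨j, hj, rfl⟩ hwR
      have hij : dist (y i) (y j) ≤ R + 2 := by rwa [dist_comm, dist_eq_norm]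
      obtain ⟨g, hg1, hg2⟩ := hloc j hij
      refine ⟨g.trans (AffineIsometryEquiv.vaddConst ℝ (y i)).symm, ?_, ?_⟩
      · rintro w' ⟨k, hk, rfl⟩ hjk
        rw [dist_sub_right] at hjk
        obtain ⟨z, hz, hzk⟩ := hg1 k hjk
        refine ⟨z, hz, ?_⟩
        have : (g.trans (AffineIsometryEquiv.vaddConst ℝ (y i)).symm) z = g z - y i := by
          simp [AffineIsometryEquiv.coe_trans]
        rw [this, dist_sub_right]
        exact hzk.trans hθθ₀
      · intro z hz hzw
        have hgz : (g.trans (AffineIsometryEquiv.vaddConst ℝ (y i)).symm) z = g z - y i := by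
          simp [AffineIsometryEquiv.coe_trans]
        rw [hgz, dist_sub_right] at hzw
        obtain ⟨k, hk⟩ := hg2 z hz hzw
        refine ⟨y k - y i, hmemW k ?_, ?_⟩
        · calc dist (y i) (y k) ≤ dist (y i) (y j) + dist (y j) (g z) + dist (g z) (y k) :=
                dist_triangle4 _ _ _ _
            _ ≤ (R + 2) + (3 * a + 1) + θ := by rw [dist_comm (g z)]; gcongr
            _ ≤ R + 3 * a + 4 := by linarith
        · rw [hgz, dist_sub_right]
          exact hk.trans hθθ₀
    obtain ⟨G, hG1, hG2⟩ := hKC W hWsub h0W hWsep hcharts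
    have hGz : ∀ z, (G.trans (AffineIsometryEquiv.vaddConst ℝ (y i))) z = G z + y i := fun z => by
      simp [AffineIsometryEquiv.coe_trans]
    refine ⟨G.trans (AffineIsometryEquiv.vaddConst ℝ (y i)), ?_, ?_⟩
    · intro k hk
      have hkW : y k - y i ∈ W := hmemW k (by linarith [hr.le])
      obtain ⟨z, hz, hzk⟩ := hG1 (y k - y i) hkW (by rwa [dist_comm, dist_zero_right, ← dist_eq_norm, dist_comm])
      refine ⟨z, hz, ?_⟩
      rw [hGz, ← dist_sub_right _ _ (y i), add_sub_cancel_right]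
      exact hzk
    · intro z hz hzR
      rw [hGz, dist_comm, dist_eq_norm, add_sub_cancel_right, ← dist_zero_right, dist_comm] at hzR
      obtain ⟨w', ⟨k, hk, rfl⟩, hkz⟩ := hG2 z hz hzR
      refine ⟨k, ?_⟩
      rw [hGz, ← dist_sub_right _ _ (y i), add_sub_cancel_right]
      exact hkz
  -- blame the unmatched sites on a locally unmatched site within `R + 2`
  have hcount := hblame N y hsep (fun i => (∃ g : EuclideanSpace ℝ (Fin 3) ≃ᵃⁱ[ℝ] EuclideanSpace ℝ (Fin 3), (∀ j : Fin N, dist (y i) (y j) ≤ R → ∃ z ∈ Literature.MathematicalPhysics.StatisticalMechanics.barlowStacking a h Literature.MathematicalPhysics.StatisticalMechanics.alternatingHagg, dist (y j) (g z) ≤ ε) ∧ (∀ z ∈ Literature.MathematicalPhysics.StatisticalMechanics.barlowStacking a h Literature.MathematicalPhysics.StatisticalMechanics.alternatingHagg, dist (y i) (g z) ≤ R → ∃ j : Fin N, dist (y j) (g z) ≤ ε)))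
    (fun j => ¬ (∃ g : EuclideanSpace ℝ (Fin 3) ≃ᵃⁱ[ℝ] EuclideanSpace ℝ (Fin 3), (∀ k : Fin N, dist (y j) (y k) ≤ (3 * a + 1) → ∃ z ∈ Literature.MathematicalPhysics.StatisticalMechanics.barlowStacking a h Literature.MathematicalPhysics.StatisticalMechanics.alternatingHagg, dist (y k) (g z) ≤ θ) ∧ (∀ z ∈ Literature.MathematicalPhysics.StatisticalMechanics.barlowStacking a h Literature.MathematicalPhysics.StatisticalMechanics.alternatingHagg, dist (y j) (g z) ≤ (3 * a + 1) → ∃ k : Fin N, dist (y k) (g z) ≤ θ))) (fun i hi => by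
      by_contra hcon
      exact hi (key i fun j hj => by
        by_contra hj'
        exact hcon ⟨j, hj', hj⟩))
  -- counting: `#matched = N − #unmatched ≥ N − Cb ν N ≥ N/2`
  have hsplit : (Nat.card {i : Fin N // (∃ g : EuclideanSpace ℝ (Fin 3) ≃ᵃⁱ[ℝ] EuclideanSpace ℝ (Fin 3), (∀ j : Fin N, dist (y i) (y j) ≤ R → ∃ z ∈ Literature.MathematicalPhysics.StatisticalMechanics.barlowStacking a h Literature.MathematicalPhysics.StatisticalMechanics.alternatingHagg, dist (y j) (g z) ≤ ε) ∧ (∀ z ∈ Literature.MathematicalPhysics.StatisticalMechanics.barlowStacking a h Literature.MathematicalPhysics.StatisticalMechanics.alternatingHagg, dist (y i) (g z) ≤ R → ∃ j : Fin N, dist (y j) (g z) ≤ ε))} : ℝ)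
      + (Nat.card {i : Fin N // ¬ (∃ g : EuclideanSpace ℝ (Fin 3) ≃ᵃⁱ[ℝ] EuclideanSpace ℝ (Fin 3), (∀ j : Fin N, dist (y i) (y j) ≤ R → ∃ z ∈ Literature.MathematicalPhysics.StatisticalMechanics.barlowStacking a h Literature.MathematicalPhysics.StatisticalMechanics.alternatingHagg, dist (y j) (g z) ≤ ε) ∧ (∀ z ∈ Literature.MathematicalPhysics.StatisticalMechanics.barlowStacking a h Literature.MathematicalPhysics.StatisticalMechanics.alternatingHagg, dist (y i) (g z) ≤ R → ∃ j : Fin N, dist (y j) (g z) ≤ ε))} : ℝ) = N := by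
    classical
    -- card {¬p} = card (Fin N) - card {p}
    have h1 : (Nat.card {i : Fin N // ¬ (∃ g : EuclideanSpace ℝ (Fin 3) ≃ᵃⁱ[ℝ] EuclideanSpace ℝ (Fin 3), (∀ j : Fin N, dist (y i) (y j) ≤ R → ∃ z ∈ Literature.MathematicalPhysics.StatisticalMechanics.barlowStacking a h Literature.MathematicalPhysics.StatisticalMechanics.alternatingHagg, dist (y j) (g z) ≤ ε) ∧ (∀ z ∈ Literature.MathematicalPhysics.StatisticalMechanics.barlowStacking a h Literature.MathematicalPhysics.StatisticalMechanics.alternatingHagg, dist (y i) (g z) ≤ R → ∃ j : Fin N, dist (y j) (g z) ≤ ε))}) + Nat.card {i : Fin N // (∃ g : EuclideanSpace ℝ (Fin 3) ≃ᵃⁱ[ℝ] EuclideanSpace ℝ (Fin 3), (∀ j : Fin N, dist (y i) (y j) ≤ R → ∃ z ∈ Literature.MathematicalPhysics.StatisticalMechanics.barlowStacking a h Literature.MathematicalPhysics.StatisticalMechanics.alternatingHagg, dist (y j) (g z) ≤ ε) ∧ (∀ z ∈ Literature.MathematicalPhysics.StatisticalMechanics.barlowStacking a h Literature.MathematicalPhysics.StatisticalMechanics.alternatingHagg,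 dist (y i) (g z) ≤ R → ∃ j : Fin N, dist (y j) (g z) ≤ ε))}
        = N := by
      rw [Nat.card_eq_fintype_card, Nat.card_eq_fintype_card, Fintype.card_subtype_compl,
        Nat.sub_add_cancel (Fintype.card_subtype_le _), Fintype.card_fin]
    have h2 : ((Nat.card {i : Fin N // ¬ (∃ g : EuclideanSpace ℝ (Fin 3) ≃ᵃⁱ[ℝ] EuclideanSpace ℝ (Fin 3), (∀ j : Fin N, dist (y i) (y j) ≤ R → ∃ z ∈ Literature.MathematicalPhysics.StatisticalMechanics.barlowStacking a h Literature.MathematicalPhysics.StatisticalMechanics.alternatingHagg, dist (y j) (g z) ≤ ε) ∧ (∀ z ∈ Literature.MathematicalPhysics.StatisticalMechanics.barlowStacking a h Literature.MathematicalPhysics.StatisticalMechanics.alternatingHagg, dist (y i) (g z) ≤ R → ∃ j : Fin N, dist (y j) (g z) ≤ ε))} + Nat.card {i : Fin N // (∃ g : EuclideanSpace ℝ (Fin 3) ≃ᵃⁱ[ℝ] EuclideanSpace ℝ (Fin 3), (∀ j : Fin N, dist (y i) (y j) ≤ R → ∃ z ∈ Literature.MathematicalPhysics.StatisticalMechanics.barlowStacking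 a h Literature.MathematicalPhysics.StatisticalMechanics.alternatingHagg, dist (y j) (g z) ≤ ε) ∧ (∀ z ∈ Literature.MathematicalPhysics.StatisticalMechanics.barlowStacking a h Literature.MathematicalPhysics.StatisticalMechanics.alternatingHagg, dist (y i) (g z) ≤ R → ∃ j : Fin N, dist (y j) (g z) ≤ ε))} : ℕ) : ℝ)
        = N := by exact_mod_cast h1
    push_cast at h2
    linarith
  have hN0 : (0 : ℝ) ≤ N := Nat.cast_nonneg N
  have hCbν : Cb * ν ≤ 1 / 2 := by
    rw [hνdef]
    rw [show Cb * (1 / (2 * (Cb + 1))) = (Cb / (Cb + 1)) * (1 / 2) by field_simp]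
    have : Cb / (Cb + 1) ≤ 1 := (div_le_one (by positivity)).2 (by linarith)
    linarith
  have hbad : (Nat.card {i : Fin N // ¬ (∃ g : EuclideanSpace ℝ (Fin 3) ≃ᵃⁱ[ℝ] EuclideanSpace ℝ (Fin 3), (∀ j : Fin N, dist (y i) (y j) ≤ R → ∃ z ∈ Literature.MathematicalPhysics.StatisticalMechanics.barlowStacking a h Literature.MathematicalPhysics.StatisticalMechanics.alternatingHagg, dist (y j) (g z) ≤ ε) ∧ (∀ z ∈ Literature.MathematicalPhysics.StatisticalMechanics.barlowStacking a h Literature.MathematicalPhysics.StatisticalMechanics.alternatingHagg, dist (y i) (g z) ≤ R → ∃ j : Fin N, dist (y j) (g z) ≤ ε))} : ℝ) ≤ 1 / 2 * N := by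
    calc (Nat.card {i : Fin N // ¬ (∃ g : EuclideanSpace ℝ (Fin 3) ≃ᵃⁱ[ℝ] EuclideanSpace ℝ (Fin 3), (∀ j : Fin N, dist (y i) (y j) ≤ R → ∃ z ∈ Literature.MathematicalPhysics.StatisticalMechanics.barlowStacking a h Literature.MathematicalPhysics.StatisticalMechanics.alternatingHagg, dist (y j) (g z) ≤ ε) ∧ (∀ z ∈ Literature.MathematicalPhysics.StatisticalMechanics.barlowStacking a h Literature.MathematicalPhysics.StatisticalMechanics.alternatingHagg, dist (y i) (g z) ≤ R → ∃ j : Fin N, dist (y j) (g z) ≤ ε))} : ℝ)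
        ≤ Cb * (Nat.card {j : Fin N // ¬ (∃ g : EuclideanSpace ℝ (Fin 3) ≃ᵃⁱ[ℝ] EuclideanSpace ℝ (Fin 3), (∀ k : Fin N, dist (y j) (y k) ≤ (3 * a + 1) → ∃ z ∈ Literature.MathematicalPhysics.StatisticalMechanics.barlowStacking a h Literature.MathematicalPhysics.StatisticalMechanics.alternatingHagg, dist (y k) (g z) ≤ θ) ∧ (∀ z ∈ Literature.MathematicalPhysics.StatisticalMechanics.barlowStacking a h Literature.MathematicalPhysics.StatisticalMechanics.alternatingHagg, dist (y j) (g z) ≤ (3 * a + 1) → ∃ k : Fin N, dist (y k) (g z) ≤ θ))} : ℝ) := hcount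
      _ ≤ Cb * (ν * N) := mul_le_mul_of_nonneg_left hbadloc hCb0
      _ = (Cb * ν) * N := by ring
      _ ≤ 1 / 2 * N := mul_le_mul_of_nonneg_right hCbν hN0
  linarith [hsplit, hbad]

end Summit.AtomisticToContinuum.Crystallization.Theorems.PricedHcpWindowsWeakOfLocal
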